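import Summits.Ventures.PercRepro.C026HGraph
import Summits.Ventures.PercRepro.C026Hall

/-!
# The symmetric strengthening (★′) of the D-free inequality (mine-3 14:35:24Z; dossier §11 S5) (p5, gen 7)

`(★′)`: for every marked multigraph, `#{S ∈ bot : K ~ L in H_S − c} ≤ #{S ∈ bot : O1 ∨ O2}` — every term a
connectivity in the H-graph of ONE bot configuration, and the left side does not involve the edges at `c`.

* `hAdj_symm` / `hConnAvoid_symm` — H-steps and H-walks are symmetric;
* **`StarPrimeIneq a b c`** — `(★′)` with `K ~ L in H − c` as `HConnAvoid S c {c} a b`;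
* the walk lemma **`hConnAvoid_of_hConn_of_not`**: if `a ~_H b` but every H-walk from `a` to `b` passes
  through `c`, the prefix up to the first visit of `c` avoids `L` (otherwise its `L`-vertex gives a
  `c`-free walk to `b`), so `c ~_H a` in `H − L`; symmetrically `c ~_H b` in `H − K`;
* **`dFreeIneq_of_starPrime`** — `(★′) ⟹ (★) = DFreeIneq`:
  `#{bot : a ~_H b} ≤ #{bot : a ~_H b avoiding c} + #{bot : O1 ∧ O2} ≤ #{bot : O1 ∨ O2} + #{bot : O1 ∧ O2}
  = #{bot : O1} + #{bot : O2}`; hence **`C026UpTo_of_starPrime`**.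
-/

namespace PercRepro

open Finset

namespace MultiGraph

section StarPrime

variable {V E : Type*} (G : MultiGraph V E)

/-- `Joins` is symmetric. -/
theorem joins_symm {e : E} {u v : V} (h : G.Joins e u v) : G.Joins e v u := by
  rcases h with ⟨h1, h2⟩ | ⟨h1, h2⟩
  · exact Or.inr ⟨h1, h2⟩
  · exact Or.inl ⟨h1, h2⟩

/-- H-steps are symmetric. -/
theorem hAdj_symm {S : Config E} {c u v : V} (h : G.HAdj S c u v) : G.HAdj S c v u := by
  rcases h with ⟨hu, hv, e, he, hj⟩ | ⟨hiff, e, hj⟩ | ⟨hu, hv, hc⟩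
  · exact Or.inl ⟨hv, hu, e, he, G.joins_symm hj⟩
  · refine Or.inr (Or.inl ⟨?_, e, G.joins_symm hj⟩)
    constructor
    · intro hv hu
      exact hiff.mp hu hv
    · intro hu
      by_contra hv
      exact hu (hiff.mpr hv)
  · exact Or.inr (Or.inr ⟨hv, hu, hc.symm⟩)

/-- H-walks avoiding `X` are symmetric. -/
theorem hConnAvoid_symm {S : Config E} {c : V} {X : Set V} {u v : V}
    (h : G.HConnAvoid S c X u v) : G.HConnAvoid S c X v u := by
  unfold HConnAvoid at h ⊢
  induction h with
  | refl => exact Relation.ReflTransGen.refl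
  | tail _ hxy ih =>
    exact Relation.ReflTransGen.head ⟨G.hAdj_symm hxy.1, hxy.2.2, hxy.2.1⟩ ih

/-- H-walks are symmetric. -/
theorem hConn_symm {S : Config E} {c u v : V} (h : G.HConn S c u v) : G.HConn S c v u := by
  unfold HConn at h ⊢
  induction h with
  | refl => exact Relation.ReflTransGen.refl
  | tail _ hxy ih => exact Relation.ReflTransGen.head (G.hAdj_symm hxy) ih

/-- An H-walk avoiding `X` is an H-walk. -/
theorem hConn_of_hConnAvoid {S : Config E} {c : V} {X : Set V} {u v : V}
    (h : G.HConnAvoid S c X u v) : G.HConn S c u v := by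
  unfold HConnAvoid at h
  unfold HConn
  induction h with
  | refl => exact Relation.ReflTransGen.refl
  | tail _ hxy ih => exact ih.tail hxy.1

/-- **Splitting an H-walk at the first visit of `c`**: from `x ≠ c`, either a `c`-free walk reaches `b`,
or a walk whose vertices before the end are `≠ c` reaches `c`. -/
theorem hConn_split {S : Config E} {c b : V} (hbc : b ≠ c) {x : V} (h : G.HConn S c x b) (hx : x ≠ c) :
    G.HConnAvoid S c {c} x b ∨
      Relation.ReflTransGen (fun x y => G.HAdj S c x y ∧ x ≠ c) x c := by
  unfold HConn at h
  induction h using Relation.ReflTransGen.head_induction_on with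
  | refl => exact Or.inl Relation.ReflTransGen.refl
  | @head x y hxy _ ih =>
    by_cases hyc : y = c
    · subst hyc
      exact Or.inr (Relation.ReflTransGen.single ⟨hxy, hx⟩)
    · rcases ih hyc with h1 | h1
      · exact Or.inl (Relation.ReflTransGen.head ⟨hxy, hx, hyc⟩ h1)
      · exact Or.inr (Relation.ReflTransGen.head ⟨hxy, hx⟩ h1)

/-- **The prefix avoids `L`**: a walk from `x ∉ L` to `c` with all vertices before the end `≠ c` either
avoids `L`, or meets `L` and then gives a `c`-free walk from `x` to `b`. -/
theorem hConnAvoid_cluster_of_walk {S : Config E} {a b c : V} (h : G.IsBot S a b c) {x : V}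
    (hw : Relation.ReflTransGen (fun x y => G.HAdj S c x y ∧ x ≠ c) x c) (hx : x ∉ G.cluster S b) :
    G.HConnAvoid S c (G.cluster S b) x c ∨ G.HConnAvoid S c {c} x b := by
  have hcL : c ∉ G.cluster S b := fun hc => h.2.2 (hc : G.Conn S b c)
  have hbM : b ∉ G.cluster S c := fun hb => h.2.2 (hb : G.Conn S c b).symm
  induction hw using Relation.ReflTransGen.head_induction_on with
  | refl => exact Or.inl Relation.ReflTransGen.refl
  | @head x y hxy _ ih =>
    obtain ⟨hadj, hxc⟩ := hxy
    by_cases hyL : y ∈ G.cluster S b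
    · -- `y ∈ L`: go to `b` inside `L` — a `c`-free walk
      have hyc : y ≠ c := fun hyc => hcL (hyc ▸ hyL)
      have hyM : y ∉ G.cluster S c := fun hyM => h.2.2 ((hyL : G.Conn S b y).trans (hyM : G.Conn S c y).symm)
      have hstep : G.HAdj S c y b := Or.inr (Or.inr ⟨hyM, hbM, (hyL : G.Conn S b y).symm⟩)
      have hbc : b ≠ c := fun hbc => h.2.2 (hbc ▸ Conn.refl G S b)
      exact Or.inr (Relation.ReflTransGen.head ⟨hadj, hxc, hyc⟩
        (Relation.ReflTransGen.single ⟨hstep, hyc, hbc⟩))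
    · rcases ih hyL with h1 | h1
      · exact Or.inl (Relation.ReflTransGen.head ⟨hadj, hx, hyL⟩ h1)
      · by_cases hyc : y = c
        · -- a `c`-free walk cannot start at `c`
          subst hyc
          exfalso
          have hbc : b ≠ y := fun hbc => h.2.2 (hbc ▸ Conn.refl G S b)
          rcases Relation.ReflTransGen.cases_head h1 with h2 | ⟨_, ⟨_, hcc, _⟩, _⟩
          · exact hbc h2.symm
          · exact hcc rfl
        · exact Or.inr (Relation.ReflTransGen.head ⟨hadj, hxc, hyc⟩ h1)

/-- **The walk lemma**: for `S ∈ bot`, if `a ~_H b` but no H-walk from `a` to `b` avoids `c`, then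
`c ~_H a` in `H − L`. -/
theorem hConnAvoid_of_hConn_of_not {S : Config E} {a b c : V} (h : G.IsBot S a b c)
    (hab : G.HConn S c a b) (hno : ¬ G.HConnAvoid S c {c} a b) :
    G.HConnAvoid S c (G.cluster S b) c a := by
  have hac : a ≠ c := fun hac => h.2.1 (hac ▸ Conn.refl G S a)
  have hbc : b ≠ c := fun hbc => h.2.2 (hbc ▸ Conn.refl G S b)
  have haL : a ∉ G.cluster S b := fun ha => h.1 (ha : G.Conn S b a).symm
  rcases G.hConn_split hbc hab hac with h1 | h1
  · exact absurd h1 hno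
  · rcases G.hConnAvoid_cluster_of_walk h h1 haL with h2 | h2
    · exact G.hConnAvoid_symm h2
    · exact absurd h2 hno

/-- The roles of `a` and `b` swap: `IsBot S b a c`. -/
theorem isBot_swap {S : Config E} {a b c : V} (h : G.IsBot S a b c) : G.IsBot S b a c :=
  ⟨fun hba => h.1 hba.symm, h.2.2, h.2.1⟩

/-- **Both offers from a walk through `c`**: for `S ∈ bot` with `a ~_H b` and no `c`-free walk,
`O1 S ∧ O2 S`. -/
theorem o1_and_o2_of_hConn_of_not {S : Config E} {a b c : V} (h : G.IsBot S a b c)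
    (hab : G.HConn S c a b) (hno : ¬ G.HConnAvoid S c {c} a b) : G.O1 S a b c ∧ G.O2 S a b c := by
  refine ⟨⟨h, (G.cellAC_kSwapSealed_iff h).mpr (G.hConnAvoid_of_hConn_of_not h hab hno)⟩,
    ⟨h, (G.cellBC_kSwapSealed_iff h).mpr ?_⟩⟩
  -- the symmetric statement with `a` and `b` swapped
  have hba : G.HConn S c b a := G.hConn_symm hab
  have hno' : ¬ G.HConnAvoid S c {c} b a := fun h' => hno (G.hConnAvoid_symm h')
  exact G.hConnAvoid_of_hConn_of_not (G.isBot_swap h) hba hno'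

variable [Fintype E] [DecidableEq E]

open Classical in
/-- **mine-3's symmetric strengthening `(★′)`**: `#{S ∈ bot : a ~_H b avoiding c} ≤ #{S ∈ bot : O1 ∨ O2}`. -/
def StarPrimeIneq (a b c : V) : Prop :=
  (Finset.univ.filter fun ω : Config E => G.IsBot ω a b c ∧ G.HConnAvoid ω c {c} a b).card ≤
    (Finset.univ.filter fun ω : Config E => G.IsBot ω a b c ∧ (G.O1 ω a b c ∨ G.O2 ω a b c)).card

open Classical in
/-- **`(★′)` gives the D-free inequality**. -/
theorem dFreeIneq_of_starPrime {a b c : V} (h : G.StarPrimeIneq a b c) : G.DFreeIneq a b c := by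
  rw [G.dFreeIneq_iff_hGraph]
  -- the left side splits: `c`-free walks, or both offers
  have hsplit : (Finset.univ.filter fun ω : Config E => G.IsBot ω a b c ∧ G.HConn ω c a b) ⊆
      (Finset.univ.filter fun ω : Config E => G.IsBot ω a b c ∧ G.HConnAvoid ω c {c} a b) ∪
        (Finset.univ.filter fun ω : Config E => G.IsBot ω a b c ∧ (G.O1 ω a b c ∧ G.O2 ω a b c)) := by
    intro ω hω
    simp only [Finset.mem_filter, Finset.mem_univ, true_and, Finset.mem_union] at hω ⊢
    by_cases hfree : G.HConnAvoid ω c {c} a b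
    · exact Or.inl ⟨hω.1, hfree⟩
    · exact Or.inr ⟨hω.1, G.o1_and_o2_of_hConn_of_not hω.1 hω.2 hfree⟩
  have h1 := Finset.card_le_card hsplit
  have h2 := Finset.card_union_le
    (Finset.univ.filter fun ω : Config E => G.IsBot ω a b c ∧ G.HConnAvoid ω c {c} a b)
    (Finset.univ.filter fun ω : Config E => G.IsBot ω a b c ∧ (G.O1 ω a b c ∧ G.O2 ω a b c))
  -- inclusion–exclusion on the offers
  have h3 := Finset.card_union_add_card_inter
    (Finset.univ.filter fun ω : Config E => G.IsBot ω a b c ∧ G.O1 ω a b c)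
    (Finset.univ.filter fun ω : Config E => G.IsBot ω a b c ∧ G.O2 ω a b c)
  have e1 : (Finset.univ.filter fun ω : Config E => G.IsBot ω a b c ∧ G.O1 ω a b c) ∪
      (Finset.univ.filter fun ω : Config E => G.IsBot ω a b c ∧ G.O2 ω a b c) =
      Finset.univ.filter fun ω : Config E => G.IsBot ω a b c ∧ (G.O1 ω a b c ∨ G.O2 ω a b c) := by
    ext ω
    simp only [Finset.mem_union, Finset.mem_filter, Finset.mem_univ, true_and]
    tauto
  have e2 : (Finset.univ.filter fun ω : Config E => G.IsBot ω a b c ∧ G.O1 ω a b c) ∩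
      (Finset.univ.filter fun ω : Config E => G.IsBot ω a b c ∧ G.O2 ω a b c) =
      Finset.univ.filter fun ω : Config E => G.IsBot ω a b c ∧ (G.O1 ω a b c ∧ G.O2 ω a b c) := by
    ext ω
    simp only [Finset.mem_inter, Finset.mem_filter, Finset.mem_univ, true_and]
    tauto
  rw [e1, e2] at h3
  -- the offers in the H-graph vocabulary
  have e3 : (Finset.univ.filter fun ω : Config E => G.IsBot ω a b c ∧ G.O1 ω a b c) =
      Finset.univ.filter fun ω : Config E =>
        G.IsBot ω a b c ∧ G.HConnAvoid ω c (G.cluster ω b) c a := by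
    ext ω
    simp only [Finset.mem_filter, Finset.mem_univ, true_and, O1]
    constructor
    · rintro ⟨h1, _, h2⟩
      exact ⟨h1, (G.cellAC_kSwapSealed_iff h1).mp h2⟩
    · rintro ⟨h1, h2⟩
      exact ⟨h1, h1, (G.cellAC_kSwapSealed_iff h1).mpr h2⟩
  have e4 : (Finset.univ.filter fun ω : Config E => G.IsBot ω a b c ∧ G.O2 ω a b c) =
      Finset.univ.filter fun ω : Config E =>
        G.IsBot ω a b c ∧ G.HConnAvoid ω c (G.cluster ω a) c b := by
    ext ω
    simp only [Finset.mem_filter, Finset.mem_univ, true_and, O2]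
    constructor
    · rintro ⟨h1, _, h2⟩
      exact ⟨h1, (G.cellBC_kSwapSealed_iff h1).mp h2⟩
    · rintro ⟨h1, h2⟩
      exact ⟨h1, h1, (G.cellBC_kSwapSealed_iff h1).mpr h2⟩
  rw [e3, e4] at h3
  unfold StarPrimeIneq at h
  omega

end StarPrime

end MultiGraph

/-- **`(★′)` on the simple graphs with ≤ N vertices and three distinct marks.** -/
def StarPrimeSimpleUpTo (N : ℕ) : Prop :=
  ∀ {V E : Type} [Fintype V] [Fintype E] [DecidableEq E], Fintype.card V ≤ N →
    ∀ (G : MultiGraph V E), G.IsSimple → ∀ a b c : V, a ≠ b → a ≠ c → b ≠ c → G.StarPrimeIneq a b c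

/-- **C-026 on every multigraph with ≤ N vertices, at every `p`, from `(★′)` on the simple graphs with
≤ N vertices.** -/
theorem C026UpTo_of_starPrime {N : ℕ} (h : StarPrimeSimpleUpTo N) : C026UpTo N :=
  C026UpTo_of_dFree fun hV G hs a b c hab hac hbc =>
    G.dFreeIneq_of_starPrime (h hV G hs a b c hab hac hbc)

end PercRepro
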